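import Summits.QuantumFields.YangMills.Theorems.UnitScaleTiltProp7AxialOffsetFamily
import Summits.QuantumFields.YangMills.Theorems.FluctuationComparisonRegPrIntLS2BetaInterBlockAlgebra
import Literature.MathematicalPhysics.QuantumFieldTheory.Balaban1983to89.BlockAveragingPlaquetteBound
import HarnessLib

/-!
# GAP♯∘'s KINEMATIC LETTER INTER₀∘, PART A — THE CENTRAL CROSSING LINK OF A FACE
# (crux `FluctuationComparisonRegPrIntL`, stmt-QuantumFields-20520; registry v11.4 `Cruxes/FluctuationComparisonRegPrIntL/Lines/semiclassical_s2beta.lean` 3732b7df FROZEN, untouched)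

Cell `ym3-torus` (YM ladder rung R3 = continuum `SU(2)` Yang–Mills on the three-torus — a RUNG: NOT d = 4, NOT infinite volume, NOT a mass gap, NOT Clay).
Seat `ym3-torus-px8` (gen 18; pen INTER₀∘ handed over by `ymfull-r3-prover-3` g0, ★★OWNER WORD №205); `--kind proof --supports stmt-QuantumFields-20520 --as helper`,
count-neutral, DEFINITION-FREE (0 `def`, 0 `instance`, 0 `notation`, 0 `sorry`, default heartbeats).  Plan: HOME `ym3-torus-px8/g18/locate/LOCATE-INTER0-GEOMETRY-px8g18.md`.

WHAT.  INTER₀∘ (the `hI` hypothesis of ✓`…S2BetaOneStepOfInterBlock.oneStepRooted₀_of_interBlock`, [Balaban1985RegularSpaces] Lemma 1 (1.25) second half) bounds the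
bonds JOINING two neighbouring blocks of ONE block level in the relative comb-axial gauge.  This file handles the CENTRAL crossing link `ℓ₀ = ⟨x₀, μ⟩` of the
face between `B(y)` and `B(y + e_μ)`, `x₀ = emb y + h·e_μ` (`h = (L−1)∕2`, `L` odd):
* §1 the axis point: `rel`∕`blockOf` of `x₀` and of `x₀ + e_μ` (the first site of the next block on the axis), and `emb (y + e_μ) = (x₀ + e_μ) + h·e_μ`;
* §2 ★ `axialAvg_eq_axialT_mul_mul_inv` — THE CENTRAL SPLIT (any group, any level): the straight transporter `U(c)` of the coarse bond `c = ⟨y, μ⟩`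
  ([Balaban1987RG1] (0.4): `Ū(c) = corr·U(c)`) is `U(Γ_{y,x₀})·U(ℓ₀)·U(Γ_{y+e_μ, x₀+e_μ})⁻¹`: its two half-segments ARE comb paths of the two blocks
  (tree: `Prop7AxialOffsetFamily.axialT_transl_seg`, `treeWord_single`);
* §3 ★★ `dist1_central_link_le` — for two `SU(N)` fields with plaquettes within `a` of `1`, the SAME comb transporters at `x₀` and `x₀ + e_μ`, and (0.4)-averages
  at `c` within `α₁`: `dist1(W(ℓ₀)·Y(ℓ₀)⁻¹) ≤ α₁ + 2·6·(((d+2)L)²∕4)·a` — coefficient ONE on `α₁`; the correction factors are priced by the tree's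
  ✓`BlockAveragingPlaquetteBound.dist1_corr_le` (so no separate MEAN∘ row is needed), the algebra is ✓`…S2BetaInterBlockAlgebra` (`ymfull-r3-prover-3` №8:
  `dist1_mul_inv_eq_of_conj_transport`, `dist1_transport_ratio_le_of_corr`) consumed token for token.

HONEST: kinematics of one face's central link; INTER₀∘ (all crossing links), CLOSE-PAIR∘, GAP♯∘, crux 20520 are NOT proved here; no summit statement is proved by a
helper; finite-volume ∕ conditional; rung R3 = SU(2) YM₃ on T³ — NOT d = 4, NOT infinite volume, NOT a mass gap, NOT Clay; the Yang–Mills mass gap is NOT proved.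
Sorry-free, axioms standard.

References: T. Bałaban, CMP **99** (1985) 75–102 [Balaban1985RegularSpaces] ((1.19) p.79, Lemma 1 (1.24)–(1.26) pp.79–80); CMP **98** (1985) 17–51 [Balaban1985Averaging]
((9) p.18, (19)–(20) p.21, pp.24–25); CMP **109** (1987) 249–301 [Balaban1987RG1] ((0.3)–(0.4) pp.252–253).
-/

set_option autoImplicit false

noncomputable section

namespace Summit.QuantumFields.YangMills.Theorems.FluctuationComparisonRegPrIntLS2BetaInterBlockCentral

open Literature.MathematicalPhysics.QuantumFieldTheory.Balaban1983to89
open T4Continuum BlockAveraging AveragingRT ExpMeanLog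
open B7Prop1Explicit (Letter e e_apply seg seg_natCast disp_seg treeWord)
open B10Eq27TorusAxialLog (holT axialT rel transl transl_apply transl_add transl_add_e transl_zero rel_transl_of_mem transl_rel
  holT_append holT_cons_true holT_eq_holAt)
open Summit.QuantumFields.YangMills.Theorems.Prop7AxialOffsetFamily (treeWord_single axialT_transl_seg)
open Summit.QuantumFields.YangMills.Theorems.FluctuationComparisonRegPrIntLS2BetaInterBlockAlgebra
  (dist1_mul_inv_eq_of_conj_transport dist1_transport_ratio_le_of_corr)

variable {P : Params} {j : ℕ}

/-! ## §1 The axis point `x₀ = emb y + h·e_μ` and the first site `x₀ + e_μ` of the next block -/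

section Geometry

/-- No wrap-around within reach `h + 1` of a block centre: an integer vector with coordinates of size `≤ (L−1)∕2 + 1` lies in the symmetric window of the
period `2L^{m+K−j} ≥ 2L` (standing range). [cite: Balaban1987RG1, (0.1) p.251] -/
theorem window_of_natAbs_le (hj : j + 1 ≤ P.m + P.K) {z : B7Prop1Explicit.Site P.d}
    (hz : ∀ ν, (z ν).natAbs ≤ (P.L - 1) / 2 + 1) (ν : Fin P.d) :
    z ν * 2 ∈ Set.Ioc (-(P.sitesPerDir j : ℤ)) (P.sitesPerDir j) := by
  have hL := two_mul_half_add_one P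
  have hL1 := P.hL.2
  have hn : P.sitesPerDir j = P.sitesPerDir (j + 1) * P.L := P.sitesPerDir_eq_mul_succ hj
  have hn1 : 2 ≤ P.sitesPerDir (j + 1) := P.one_lt_sitesPerDir (j + 1)
  have hN : 2 * P.L ≤ P.sitesPerDir j := by rw [hn]; exact Nat.mul_le_mul_right _ hn1
  have hzν := hz ν
  have h12 : (z ν : ℤ) ≤ ((P.L - 1) / 2 : ℕ) + 1 ∧ -((((P.L - 1) / 2 : ℕ) : ℤ) + 1) ≤ z ν := by
    rcases Int.natAbs_eq (z ν) with hh' | hh' <;> rw [hh'] <;> constructor <;> omega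
  have hL3 : 3 ≤ P.L := by obtain ⟨k, hk⟩ := P.hL.1; omega
  obtain ⟨h1, h2⟩ := h12
  constructor <;> omega

/-- The relative position, with respect to the block centre, of a site within reach `h + 1` of it is the displacement itself. [cite: Balaban1987RG1, (0.3) p.252] -/
theorem rel_emb_transl (hj : j + 1 ≤ P.m + P.K) (y : Site P (j + 1)) {z : B7Prop1Explicit.Site P.d}
    (hz : ∀ ν, (z ν).natAbs ≤ (P.L - 1) / 2 + 1) : rel (emb y) (transl (emb y) z) = z :=
  rel_transl_of_mem _ _ (window_of_natAbs_le hj hz)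

/-- A site displaced from the centre by at most `h = (L−1)∕2` in every coordinate lies in the block. [cite: Balaban1987RG1, (0.3) p.252] -/
theorem blockOf_transl_emb (hj : j + 1 ≤ P.m + P.K) (y : Site P (j + 1)) {z : B7Prop1Explicit.Site P.d}
    (hz : ∀ ν, (z ν).natAbs ≤ (P.L - 1) / 2) : blockOf (transl (emb y) z) = y :=
  blockOf_eq_of_near_emb hj y _ z (fun ν => transl_apply _ _ ν) fun ν => by
    have h3 := hz ν
    rcases Int.natAbs_eq (z ν) with hh | hh <;> rw [hh] <;> constructor <;> omega

/-- The axis vector `h·e_μ` has coordinates of size `≤ h`. [folklore] -/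
theorem natAbs_axisVec_le (μ ν : Fin P.d) :
    (((((P.L - 1) / 2 : ℕ) : ℤ) • e μ : B7Prop1Explicit.Site P.d) ν).natAbs ≤ (P.L - 1) / 2 := by
  rw [Pi.smul_apply, e_apply]
  split_ifs
  · rw [smul_eq_mul, mul_one, Int.natAbs_natCast]
  · rw [smul_zero, Int.natAbs_zero]; exact Nat.zero_le _

/-- `−h·e_μ` has coordinates of size `≤ h`. [folklore] -/
theorem natAbs_neg_axisVec_le (μ ν : Fin P.d) :
    (((-((((P.L - 1) / 2 : ℕ) : ℤ)) • e μ : B7Prop1Explicit.Site P.d) ν).natAbs ≤ (P.L - 1) / 2) := by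
  rw [Pi.smul_apply, e_apply]
  split_ifs
  · rw [smul_eq_mul, mul_one, Int.natAbs_neg, Int.natAbs_natCast]
  · rw [smul_zero, Int.natAbs_zero]; exact Nat.zero_le _

/-- **The axis point `x₀ = emb y + h·e_μ` lies in `B(y)`.** [cite: Balaban1987RG1, (0.3) p.252] -/
theorem blockOf_axisPt (hj : j + 1 ≤ P.m + P.K) (y : Site P (j + 1)) (μ : Fin P.d) :
    blockOf (transl (emb y) ((((P.L - 1) / 2 : ℕ) : ℤ) • e μ)) = y :=
  blockOf_transl_emb hj y (natAbs_axisVec_le μ)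

/-- **The next block centre from the first site beyond the face**: `emb (y + e_μ) = (x₀ + e_μ) + h·e_μ` (`h + 1 + h = L`). [cite: Balaban1987RG1, (0.3) p.252] -/
theorem emb_shift_eq_transl_axisPt_shift (y : Site P (j + 1)) (μ : Fin P.d) :
    emb (y.shift μ) =
      transl ((transl (emb y) ((((P.L - 1) / 2 : ℕ) : ℤ) • e μ)).shift μ) ((((P.L - 1) / 2 : ℕ) : ℤ) • e μ) := by
  rw [← transl_add_e, ← transl_add]
  funext ν
  rw [transl_apply, emb_shift_apply, Pi.add_apply, Pi.add_apply, Pi.smul_apply, e_apply]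
  have hL : ((((P.L - 1) / 2 : ℕ) : ℤ)) + 1 + (((P.L - 1) / 2 : ℕ) : ℤ) = (P.L : ℤ) := by
    exact_mod_cast (by have := two_mul_half_add_one P; omega : (P.L - 1) / 2 + 1 + (P.L - 1) / 2 = P.L)
  by_cases h : ν = μ
  · subst h
    rw [if_pos rfl, if_pos rfl, smul_eq_mul, mul_one, hL, Int.cast_natCast]
  · simp only [if_neg h, smul_zero, add_zero, Int.cast_zero]

/-- The first site beyond the face, seen from the next centre: `x₀ + e_μ = emb (y + e_μ) − h·e_μ`. [cite: Balaban1987RG1, (0.3) p.252] -/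
theorem axisPt_shift_eq_transl_emb_shift (y : Site P (j + 1)) (μ : Fin P.d) :
    (transl (emb y) ((((P.L - 1) / 2 : ℕ) : ℤ) • e μ)).shift μ =
      transl (emb (y.shift μ)) ((-(((P.L - 1) / 2 : ℕ) : ℤ)) • e μ) := by
  rw [emb_shift_eq_transl_axisPt_shift y μ, ← transl_add, neg_smul, add_neg_cancel, transl_zero]

/-- **The first site beyond the face lies in the NEXT block**: `blockOf (x₀ + e_μ) = y + e_μ`. [cite: Balaban1987RG1, (0.3) p.252] -/
theorem blockOf_axisPt_shift (hj : j + 1 ≤ P.m + P.K) (y : Site P (j + 1)) (μ : Fin P.d) :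
    blockOf ((transl (emb y) ((((P.L - 1) / 2 : ℕ) : ℤ) • e μ)).shift μ) = y.shift μ := by
  rw [axisPt_shift_eq_transl_emb_shift]
  exact blockOf_transl_emb hj _ (natAbs_neg_axisVec_le μ)

/-- The two blocks meeting at the face are distinct (the coarse torus has at least two sites per direction), so `ℓ₀` is a CROSSING bond:
`blockOf (x₀ + e_μ) ≠ blockOf x₀`. [cite: Balaban1987RG1, (0.1) p.251] -/
theorem blockOf_axisPt_shift_ne (hj : j + 1 ≤ P.m + P.K) (y : Site P (j + 1)) (μ : Fin P.d) :
    blockOf ((transl (emb y) ((((P.L - 1) / 2 : ℕ) : ℤ) • e μ)).shift μ) ≠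
      blockOf (transl (emb y) ((((P.L - 1) / 2 : ℕ) : ℤ) • e μ)) := by
  rw [blockOf_axisPt_shift hj, blockOf_axisPt hj]
  intro h
  have h1 : (y.shift μ) μ = y μ := by rw [h]
  rw [Site.shift_apply, if_pos rfl] at h1
  have h2 : (1 : ZMod (P.sitesPerDir (j + 1))) = 0 := add_left_cancel_iff.mp (h1.trans (add_zero _).symm)
  haveI : Fact (1 < P.sitesPerDir (j + 1)) := ⟨P.one_lt_sitesPerDir (j + 1)⟩
  exact one_ne_zero h2

end Geometry

/-! ## §2 The central split of the straight transporter -/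

section Split

variable {G : Type*} [GaugeGroup G]

/-- The outgoing half-segment is the comb of `B(y)` to the axis point: `U(Γ_{y,x₀}) = U([emb y, x₀])`. [cite: Balaban1985Averaging, (9) p.18, p.24] -/
theorem axialT_emb_axisPt (hj : j + 1 ≤ P.m + P.K) (U : GaugeField P j G) (y : Site P (j + 1)) (μ : Fin P.d) :
    axialT U (emb y) (transl (emb y) ((((P.L - 1) / 2 : ℕ) : ℤ) • e μ)) =
      holT U (emb y) (seg μ (((P.L - 1) / 2 : ℕ) : ℤ)) := by
  unfold axialT
  rw [rel_emb_transl hj y (fun ν => (natAbs_axisVec_le μ ν).trans (Nat.le_succ _)), treeWord_single]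

/-- The returning half-segment is the comb of `B(y + e_μ)` to `x₀ + e_μ`, reversed: `U(Γ_{y+e_μ, x₀+e_μ}) = U([x₀+e_μ, emb(y+e_μ)])⁻¹`.
[cite: Balaban1985Averaging, (9) p.18, p.24] -/
theorem axialT_emb_shift_axisPt_shift (hj : j + 1 ≤ P.m + P.K) (U : GaugeField P j G) (y : Site P (j + 1)) (μ : Fin P.d) :
    axialT U (emb (y.shift μ)) ((transl (emb y) ((((P.L - 1) / 2 : ℕ) : ℤ) • e μ)).shift μ) =
      (holT U ((transl (emb y) ((((P.L - 1) / 2 : ℕ) : ℤ) • e μ)).shift μ) (seg μ (((P.L - 1) / 2 : ℕ) : ℤ)))⁻¹ := by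
  rw [emb_shift_eq_transl_axisPt_shift y μ]
  refine axialT_transl_seg U _ μ _ ?_
  rw [Int.natAbs_natCast]
  have h2 := two_mul_half_add_one P
  have h3 : P.L ≤ P.sitesPerDir j := by
    rw [P.sitesPerDir_eq_mul_succ hj]
    exact Nat.le_mul_of_pos_left _ (by have := P.one_lt_sitesPerDir (j + 1); omega)
  omega

/-- ★ **THE CENTRAL SPLIT.**  The straight transporter of the coarse bond `c = ⟨y, μ⟩` (the `U(c)` of [Balaban1987RG1] (0.4), tree `AveragingRT.axialAvg`: the
holonomy of the `L` links from `emb y` to `emb (y + e_μ)`) is the comb of `B(y)` to the axis point `x₀ = emb y + h·e_μ`, times the central crossing link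
`ℓ₀ = ⟨x₀, μ⟩`, times the inverse comb of `B(y + e_μ)` to `x₀ + e_μ` (standing range). [cite: Balaban1987RG1, (0.4) p.253; Balaban1985Averaging, (9) p.18, p.24] -/
theorem axialAvg_eq_axialT_mul_mul_inv (hj : j + 1 ≤ P.m + P.K) (U : GaugeField P j G) (y : Site P (j + 1)) (μ : Fin P.d) :
    axialAvg U ⟨y, μ⟩ =
      axialT U (emb y) (transl (emb y) ((((P.L - 1) / 2 : ℕ) : ℤ) • e μ)) *
        U ⟨transl (emb y) ((((P.L - 1) / 2 : ℕ) : ℤ) • e μ), μ⟩ *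
        (axialT U (emb (y.shift μ)) ((transl (emb y) ((((P.L - 1) / 2 : ℕ) : ℤ) • e μ)).shift μ))⁻¹ := by
  rw [axialT_emb_axisPt hj, axialT_emb_shift_axisPt_shift hj, inv_inv, axialAvg_eq_holAt_walk, ← holT_eq_holAt]
  have hL : List.replicate P.L (μ, true) =
      seg μ (((P.L - 1) / 2 : ℕ) : ℤ) ++ ((μ, true) :: seg μ (((P.L - 1) / 2 : ℕ) : ℤ)) := by
    rw [seg_natCast, ← List.replicate_succ, ← List.replicate_add]
    congr 1
    have := two_mul_half_add_one P
    omega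
  show holT U (emb y) (List.replicate P.L (μ, true)) = _
  rw [hL, holT_append, disp_seg, holT_cons_true, mul_assoc]

end Split

/-! ## §3 The central crossing link is within `α₁ + 2ρ` -/

section Central

open scoped Matrix.Norms.L2Operator

variable {n : Type*} [Fintype n] [DecidableEq n] [Nonempty n]

/-- ★★ **THE CENTRAL CROSSING LINK IS WITHIN `α₁ + 2ρ`.**  Two `SU(N)` configurations `W, Y` of `T^{(j)}` with every plaquette variable within `a ≥ 0` of `1`
(`(((d+2)L)²∕4)·a < δ_N`, so the correction factors of (0.4) are within `ρ = 6·(((d+2)L)²∕4)·a` of `1`, ✓`dist1_corr_le`), the SAME comb transporters from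
`emb y` to the axis point `x₀` and from `emb (y+e_μ)` to `x₀ + e_μ`, and (0.4)-averages at `c = ⟨y, μ⟩` within `α₁`: `dist1(W(ℓ₀)·Y(ℓ₀)⁻¹) ≤ α₁ + 2ρ`,
`ℓ₀ = ⟨x₀, μ⟩`. [cite: Balaban1985RegularSpaces, Lemma 1 (1.25) p.79; Balaban1987RG1, (0.4) p.253; Balaban1985Averaging, (19)-(20) p.21] -/
theorem dist1_central_link_le (hj : j + 1 ≤ P.m + P.K) {a α₁ : ℝ} (ha : 0 ≤ a)
    (W Y : GaugeField P j (Matrix.specialUnitaryGroup n ℂ)) (hW : PlaqSmall a W) (hY : PlaqSmall a Y)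
    (ht : ((((P.d + 2) * P.L : ℕ) : ℝ) ^ 2 / 4) * a < deltaSU n) (y : Site P (j + 1)) (μ : Fin P.d)
    (hax₀ : axialT W (emb y) (transl (emb y) ((((P.L - 1) / 2 : ℕ) : ℤ) • e μ)) =
      axialT Y (emb y) (transl (emb y) ((((P.L - 1) / 2 : ℕ) : ℤ) • e μ)))
    (hax₁ : axialT W (emb (y.shift μ)) ((transl (emb y) ((((P.L - 1) / 2 : ℕ) : ℤ) • e μ)).shift μ) =
      axialT Y (emb (y.shift μ)) ((transl (emb y) ((((P.L - 1) / 2 : ℕ) : ℤ) • e μ)).shift μ))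
    (havg : dist1 (avgFun (expMeanLogSU (n := n)) W ⟨y, μ⟩ * (avgFun (expMeanLogSU (n := n)) Y ⟨y, μ⟩)⁻¹) ≤ α₁) :
    dist1 (W ⟨transl (emb y) ((((P.L - 1) / 2 : ℕ) : ℤ) • e μ), μ⟩ *
        (Y ⟨transl (emb y) ((((P.L - 1) / 2 : ℕ) : ℤ) • e μ), μ⟩)⁻¹) ≤
      α₁ + 2 * (6 * (((((P.d + 2) * P.L : ℕ) : ℝ) ^ 2 / 4) * a)) := by
  unfold avgFun at havg
  rw [axialAvg_eq_axialT_mul_mul_inv hj W, axialAvg_eq_axialT_mul_mul_inv hj Y, hax₀, hax₁] at havg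
  rw [dist1_mul_inv_eq_of_conj_transport (axialT Y (emb y) (transl (emb y) ((((P.L - 1) / 2 : ℕ) : ℤ) • e μ))) _
    (axialT Y (emb (y.shift μ)) ((transl (emb y) ((((P.L - 1) / 2 : ℕ) : ℤ) • e μ)).shift μ))⁻¹]
  exact dist1_transport_ratio_le_of_corr
    (BlockAveragingPlaquetteBound.dist1_corr_le ha hW ht ⟨y, μ⟩) (BlockAveragingPlaquetteBound.dist1_corr_le ha hY ht ⟨y, μ⟩) havg

end Central

end Summit.QuantumFields.YangMills.Theorems.FluctuationComparisonRegPrIntLS2BetaInterBlockCentral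

end
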